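import Mathlib
import Summits.KontsevichZagierPeriods.Zeta5Search.CatalanQSumDiagonal
import Summits.KontsevichZagierPeriods.Zeta5Search.Denom.CatalanQBridgeProof
import HarnessLib

/-!
# Catalan box family — the exact denominator of Zudilin's `uₙ`: `den uₙ = 2^{4n − 2 s₂(n)}` for every `n`

HONEST FRAMING: systematic search; no irrationality claim unless certified.

Cell `pub-zeta5`, planner seat `fam-catalan` (gen 6); follow-up to `CatalanQSumDiagonal` (the diagonal law
`catalanQ n n n n n = 8(−1)ⁿ uₙ` for every `n`, `diagonalLaw_holds`, and the exact valuation `v₂(uₙ) = 2 s₂(n) − 4n`,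
`padicValRat_zudilin_u`).  Here `uₙ = Literature.NumberTheory.Irrationality.Zudilin2003.u n` is the solution of Zudilin's 2003
Apéry-like recursion for Catalan's constant with `u₀ = 1, u₁ = 7/4` (arXiv:math/0201024, (2)–(4)).

THEOREM (`den_zudilin_u`): the reduced denominator of `uₙ` is EXACTLY `2^{4n − 2 s₂(n)}` (`s₂` = binary digit sum), for every `n`;
hence `2^{4n} uₙ ∈ ℤ` for every `n` (`two_pow_mul_zudilin_u_isInt`; in the shape of the tree's finite-range certificate
`CatalanFamilyCertificates.sharper_inclusions` (`1 ≤ n ≤ 60`): `sharper_inclusion_u`).  Zudilin (loc. cit., Sect. 4) reports `2^{4n} uₙ ∈ ℤ` as an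
EXPERIMENTAL observation "up to `n = 1000`" ("a slightly weakened form of the inclusions is proved in [Zu4]"); his Theorem 1,
conclusion 5, proves `2^{4n+3} Dₙ uₙ ∈ ℤ` with `Dₙ = lcm(1,…,n)`.  The sharp statement is a kernel theorem here.

PROOF.  No odd prime divides `den uₙ`: fam-denom's dyadic law for the box evaluator (`Denom.CatalanBox.dyadicLaw_holds`: the reduced
denominator of `catalanQ` is a power of `2` on the whole box) on the diagonal, transported through the diagonal law
(`uₙ = catalanQ(n,…,n) · (−1)ⁿ/8`, `Rat.mul_den_dvd`) — `den_zudilin_u_dvd`; the power of `2` is then fixed by the valuation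
`padicValRat_zudilin_u` exactly as in the tree's `CatalanBeukersDenominator.den_beukersQ_half` (numerator odd by coprimality).
Nothing in this file is a statement about Catalan's constant.
-/

namespace Summit.KontsevichZagierPeriods.Zeta5Search.CatalanZudilinDenominator

open Literature.NumberTheory.Irrationality
open Summit.KontsevichZagierPeriods.Zeta5Search.CatalanQSum (catalanQ)
open Summit.KontsevichZagierPeriods.Zeta5Search.CatalanQSumDiagonal (diagonalLaw_holds padicValRat_zudilin_u)

/-- The reduced denominator of Zudilin's `uₙ` is a power of `2`: fam-denom's dyadic law for `catalanQ` (tree theorem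
`Denom.CatalanBox.dyadicLaw_holds`) on the diagonal, transported through the diagonal law `diagonalLaw_holds`. -/
theorem den_zudilin_u_dvd (n : ℕ) : ∃ m : ℕ, (Zudilin2003.u n).den = 2 ^ m := by
  rcases Nat.eq_zero_or_pos n with rfl | hn
  · exact ⟨0, by simp [Zudilin2003.u]⟩
  obtain ⟨e, he⟩ := Denom.CatalanBox.dyadicLaw_holds n n n n n (by omega) (by omega) (by omega) (by omega) (by omega)
  have h1 : ((-1 : ℚ) ^ n) ^ 2 = 1 := by rw [← pow_mul, mul_comm, pow_mul, neg_one_sq, one_pow]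
  have hu : Zudilin2003.u n = catalanQ n n n n n * ((-1) ^ n / 8) := by
    rw [diagonalLaw_holds n]; linear_combination (-(Zudilin2003.u n)) * h1
  have h8 : ((-1 : ℚ) ^ n / 8).den = 2 ^ 3 := by
    rcases Nat.even_or_odd n with h | h
    · rw [h.neg_one_pow]; decide +kernel
    · rw [h.neg_one_pow]; decide +kernel
  have hd : (Zudilin2003.u n).den ∣ 2 ^ (e + 3) := by
    rw [hu, pow_add, ← he, ← h8]; exact Rat.mul_den_dvd _ _
  obtain ⟨m, -, hm⟩ := (Nat.dvd_prime_pow Nat.prime_two).1 hd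
  exact ⟨m, hm⟩

/-- **Exact denominator of Zudilin's `uₙ`: `den uₙ = 2^{4n − 2 s₂(n)}` for every `n`** (`s₂` = binary digit sum) — no odd prime
(`den_zudilin_u_dvd`), the power of `2` fixed by `padicValRat_zudilin_u`.  This is the sharp form of `2^{4n} uₙ ∈ ℤ`, reported by
Zudilin as experimental for `n ≤ 1000` (arXiv:math/0201024, Sect. 4); his Theorem 1 (conclusion 5) proves `2^{4n+3} Dₙ uₙ ∈ ℤ`. -/
theorem den_zudilin_u (n : ℕ) : (Zudilin2003.u n).den = 2 ^ (4 * n - 2 * (Nat.digits 2 n).sum) := by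
  set q := Zudilin2003.u n with hq
  obtain ⟨a, hden⟩ := den_zudilin_u_dvd n
  have hv := padicValRat_zudilin_u n
  rw [← hq] at hden hv
  rw [padicValRat_def, hden, padicValNat.prime_pow] at hv
  have hs : (Nat.digits 2 n).sum ≤ n := Nat.digit_sum_le 2 n
  rw [hden]
  rcases Nat.eq_zero_or_pos a with rfl | hapos
  · congr 1; omega
  · have hcop : Nat.Coprime q.num.natAbs q.den := q.reduced
    rw [hden] at hcop
    have hnd : ¬ (2 : ℤ) ∣ q.num := by
      intro h
      have h2 : 2 ∣ q.num.natAbs := by omega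
      exact absurd ((Nat.Coprime.coprime_dvd_left h2 hcop).eq_one_of_dvd (dvd_pow_self 2 hapos.ne'))
        (by norm_num)
    rw [padicValInt.eq_zero_of_not_dvd hnd] at hv
    congr 1; omega

/-- `uₙ · 2^{4n − 2 s₂(n)}` is the (reduced) numerator of `uₙ`, an integer (odd for `n ≥ 1`). -/
theorem zudilin_u_mul_two_pow (n : ℕ) :
    Zudilin2003.u n * 2 ^ (4 * n - 2 * (Nat.digits 2 n).sum) = ((Zudilin2003.u n).num : ℚ) := by
  rw [← Rat.mul_den_eq_num (Zudilin2003.u n), den_zudilin_u]; push_cast; rfl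

/-- **Zudilin's observed inclusion `2^{4n} uₙ ∈ ℤ` (arXiv:math/0201024, Sect. 4, "up to `n = 1000`"), for every `n`.** -/
theorem two_pow_mul_zudilin_u_isInt (n : ℕ) : ∃ k : ℤ, 2 ^ (4 * n) * Zudilin2003.u n = k := by
  have hs : (Nat.digits 2 n).sum ≤ n := Nat.digit_sum_le 2 n
  refine ⟨2 ^ (2 * (Nat.digits 2 n).sum) * (Zudilin2003.u n).num, ?_⟩
  have h := zudilin_u_mul_two_pow n
  push_cast
  rw [← h, show (2 : ℚ) ^ (4 * n) = 2 ^ (2 * (Nat.digits 2 n).sum) * 2 ^ (4 * n - 2 * (Nat.digits 2 n).sum) by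
    rw [← pow_add]; congr 1; omega]
  ring

/-- The `u`-half of the tree's `CatalanFamilyCertificates.sharper_inclusions` (there kernel-checked for `1 ≤ n ≤ 60`), in the
same shape, for EVERY `n`: `2^{4n} uₙ ∈ ℤ`. -/
theorem sharper_inclusion_u (n : ℕ) : ∃ z : ℤ, (z : ℚ) = 2 ^ (4 * n) * Zudilin2003.u n := by
  obtain ⟨k, hk⟩ := two_pow_mul_zudilin_u_isInt n
  exact ⟨k, hk.symm⟩

/-- **K-den (bundled).** For every `n`: `v₂(uₙ) = 2 s₂(n) − 4n`, `den uₙ = 2^{4n − 2 s₂(n)}`, and `2^{4n} uₙ ∈ ℤ`. -/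
theorem zudilin_u_denominator (n : ℕ) :
    padicValRat 2 (Zudilin2003.u n) = 2 * ((Nat.digits 2 n).sum : ℤ) - 4 * (n : ℤ) ∧
      (Zudilin2003.u n).den = 2 ^ (4 * n - 2 * (Nat.digits 2 n).sum) ∧ ∃ k : ℤ, 2 ^ (4 * n) * Zudilin2003.u n = k :=
  ⟨padicValRat_zudilin_u n, den_zudilin_u n, two_pow_mul_zudilin_u_isInt n⟩

/-- Sanity by name: `den u₃ = 2⁸` (`u₃ = 19471/256`, `4·3 − 2·s₂(3) = 8`). -/
example : (Zudilin2003.u 3).den = 256 := by rw [den_zudilin_u]; norm_num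

end Summit.KontsevichZagierPeriods.Zeta5Search.CatalanZudilinDenominator
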